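import Mathlib.Analysis.SpecialFunctions.Log.Base
import Mathlib.Analysis.SpecialFunctions.Log.Basic
import Mathlib.Analysis.SpecialFunctions.Pow.Real
import Mathlib.Order.Filter.AtTopBot.Basic
import Mathlib.Topology.Order.Real
import Literature.Computability.MetaComplexity.Xorification
import Literature.Computability.MetaComplexity.XorificationLift
import Literature.Computability.MetaComplexity.StrongResolutionWidth
import Literature.Computability.MetaComplexity.StrongResolutionWidthProofs
import Literature.Computability.MetaComplexity.XorificationLiftProofs
import Literature.Computability.MetaComplexity.FpLinearSystems
import Literature.Computability.FineGrained.ProofComplexitySETH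
import HarnessLib

/-!
# Proof-complexity SETH for δ-regular resolution: the assembly (Bonacina 2017, Cor. 8.2)

Sibling proof file of `ProofComplexitySETH.lean`. The named fact
`Literature.Computability.FineGrained.deltaRegularRes_SETH` (Bonacina–Talebanfard: for every `ε > 0` there are
`δ > 0`, `k` and unsatisfiable `k`-CNFs `φ_n` on `≤ n` variables all of whose `δ`-regular
refutations eventually have `≥ 2^{(1-ε)n}` lines) is, in print, Corollary 8.2 of I. Bonacina,
*Space in Weak Propositional Proof Systems* (Springer 2017) = Cor. 6 of Bonacina–Talebanfard
(IPEC 2015), obtained from two theorems vendored as named facts in the tree: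

* `Literature.Computability.MetaComplexity.strongResWidth_kCNF` (`StrongResolutionWidth.lean`; book Thm 8.1, [BT16a];
  Beck–Impagliazzo 2013): unsatisfiable `k`-CNFs on `n` variables requiring refutation width
  `≥ (1 - ζ_k) n`, `ζ_k → 0`;
* `Literature.Computability.MetaComplexity.BonacinaTalebanfard2016_xorification` (`XorificationLift.lean`; book Thm 8.2,
  [BT16b, Thm 4], general `δ`): width `> w` for `F` forces size `≥ 2^{(1-ε)wℓ}` for
  `δ`-regular refutations of the xorification `F[⊕^ℓ] = xorify ℓ F`.

This file PROVES the assembly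
`deltaRegularRes_SETH_of_strongResWidth_of_xorification : strongResWidth_kCNF →
BonacinaTalebanfard2016_xorification → deltaRegularRes_SETH`, the derivation of the regular
case `regularRes_SETH` from `deltaRegularRes_SETH` (the interim file's preserved proof), and —
both named facts being discharged in the tree (`strongResWidth_kCNF_holds` in
`StrongResolutionWidthProofs.lean`, from `fpExpandingSystem_holds` of
`FpLinearSystemsProofs.lean` via `width_lower_bound_of_expander` of
`ExpanderWidthLowerBound.lean`; `BonacinaTalebanfard2016_xorification_holds` in
`XorificationLiftProofs.lean`) — the DISCHARGES `deltaRegularRes_SETH_holds : deltaRegularRes_SETH`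
(Bonacina 2017, Cor. 8.2; Bonacina–Talebanfard 2015, Cor. 6) and
`regularRes_SETH_holds : regularRes_SETH` (Beck–Impagliazzo 2013, Thm 1.1), together with the
one-hypothesis forms `deltaRegularRes_SETH_of_fpExpandingSystem`,
`regularRes_SETH_of_fpExpandingSystem` recording that the expanding linear systems mod `p`
(Bonacina 2017, Prop. 8.1 = Beck–Impagliazzo 2013, Lemma 4.2) are the only combinatorial input.

## Proof architecture (book, proof of Cor. 8.2, p. 118, plus the padding the book leaves implicit)

Given `ε > 0` put `η = min ε 1 / 8`.
1. Width fact: `ζ_k → 0` and hardness for all large `k`; fix `k` with `ζ_k < η` and hard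
   `k`-CNFs `F_n` (`n ≥ n₀`): every refutation has width `≥ (1 - ζ_k) n > w := ⌊(1 - 2η) n⌋`.
2. Constants: `ℓ ≥ 1` with `log₂(2e³ℓ)/ℓ ≤ η` and `m ≥ 1` with `log₂(e³ℓm)/m ≤ η/4`
   (`log₂(c·m)/m → 0`, `tendsto_logb_const_mul_div_nat`); `δ := 1/(2m)`, new width `kℓ`.
3. Family: `φ_N := F_{⌊N/ℓ⌋}[⊕^ℓ]` if `⌊N/ℓ⌋ ≥ n₀`, else `{∅}`; it is a `kℓ`-CNF on `≤ N`
   variables, unsatisfiable (`isWidthLE_xorify`, `numVars_xorify_le`, `xorify_not_satisfiable`).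
4. For `N ≥ ℓ · max(n₀, 4, ⌈1/(2η)⌉)`, `n := ⌊N/ℓ⌋`: a `δ`-regular (w.r.t. `N`) refutation is
   `1/m`-regular w.r.t. `nℓ` (`N < nℓ + ℓ ≤ 2nℓ`); Thm 8.2 gives `2^{(1-ε')wℓ} ≤ |π|` with
   `ε' = xorLiftLoss n w ℓ (1/m) ≤ η + η` (as `n/w ≤ 2`), and
   `(1-ε)N ≤ (1-8η)(nℓ+ℓ) ≤ (1-4η)nℓ - ℓ ≤ (1-2η)((1-2η)n-1)ℓ ≤ (1-ε')wℓ` since `2ηn ≥ 1`.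

## References

* I. Bonacina, *Space in Weak Propositional Proof Systems*, Springer 2017, §8.1: Cor. 8.2 and its
  proof; Thm 8.1, Thm 8.2.
* I. Bonacina, N. Talebanfard, IPEC 2015 (LIPIcs 43), Cor. 6; Algorithmica 79 (2017).
* C. Beck, R. Impagliazzo, *Strong ETH holds for regular resolution*, STOC 2013.
-/

namespace Literature.Computability.FineGrained

open Filter Complexity

/-- `log₂(c m) / m → 0` along the naturals (`c > 0`). [folklore] -/
theorem tendsto_logb_const_mul_div_nat {c : ℝ} (hc : 0 < c) :
    Tendsto (fun m : ℕ => Real.logb 2 (c * m) / m) atTop (nhds 0) := by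
  have h1 : Tendsto (fun x : ℝ => Real.log x / x) atTop (nhds 0) := by
    simpa using Real.tendsto_pow_log_div_mul_add_atTop 1 0 1 one_ne_zero
  have h2 : Tendsto (fun m : ℕ => Real.log (m : ℝ) / m) atTop (nhds 0) :=
    h1.comp tendsto_natCast_atTop_atTop
  have h3 : Tendsto (fun m : ℕ => Real.log c / (m : ℝ)) atTop (nhds 0) :=
    tendsto_const_nhds.div_atTop tendsto_natCast_atTop_atTop
  have h4 : Tendsto (fun m : ℕ => (Real.log c / m + Real.log (m : ℝ) / m) / Real.log 2) atTop
      (nhds 0) := by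
    simpa using (h3.add h2).div_const (Real.log 2)
  refine h4.congr' ?_
  filter_upwards [eventually_ge_atTop 1] with m hm
  have hm' : (0 : ℝ) < m := by exact_mod_cast hm
  rw [Real.logb, Real.log_mul hc.ne' hm'.ne']
  field_simp

end Literature.Computability.FineGrained

namespace Literature.Computability.FineGrained

open Filter Complexity MetaComplexity

/-- **Corollary 8.2 of Bonacina 2017, assembled**: the strong width lower bound (Thm 8.1) and
the xorification lift (Thm 8.2) imply the proof-complexity SETH for `δ`-regular resolution,
`deltaRegularRes_SETH`. Following the printed proof: given `ε`, take `k` with `ζ_k` small and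
the hard `k`-CNFs `F_n`; `F_n[⊕^ℓ]` for a large constant `ℓ` is a `kℓ`-CNF on `nℓ` variables
to which Thm 8.2 applies with `w = ⌊(1 - 2η) n⌋` and `δ = 1/m`; for an arbitrary number of
variables `N` one pads (`n = ⌊N/ℓ⌋`, `δ` halved), and small `N` get the trivially unsatisfiable
`{∅}`. [Bonacina 2017, Cor. 8.2; Bonacina–Talebanfard 2015, Cor. 6]
[cite: Bonacina2017, Cor. 8.2] -/
theorem deltaRegularRes_SETH_of_strongResWidth_of_xorification
    (hW : strongResWidth_kCNF)
    (hX : BonacinaTalebanfard2016_xorification) : deltaRegularRes_SETH := by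
  intro ε hε
  -- the working accuracy `η = min ε 1 / 8`
  obtain ⟨η, hη, hη8ε, hη81⟩ : ∃ η : ℝ, 0 < η ∧ 8 * η ≤ ε ∧ 8 * η ≤ 1 :=
    ⟨min ε 1 / 8, by positivity, by linarith [min_le_left ε 1], by linarith [min_le_right ε 1]⟩
  obtain ⟨ζ, hζ, hk⟩ := hW
  -- choose `k` with `ζ k < η` and hard `k`-CNFs for all large `n`
  obtain ⟨k, hζk, hPk⟩ := ((hζ.eventually_lt_const hη).and hk).exists
  obtain ⟨n₀, hn₀⟩ := eventually_atTop.1 hPk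
  choose! F hF using hn₀
  -- choose the block length `ℓ` and the regularity parameter `1/m`
  obtain ⟨ℓ, hℓ1, hℓ⟩ : ∃ ℓ : ℕ, 1 ≤ ℓ ∧ Real.logb 2 (2 * Real.exp 3 * ℓ) / ℓ ≤ η := by
    obtain ⟨ℓ, h1, h2⟩ := ((eventually_ge_atTop 1).and
      ((tendsto_logb_const_mul_div_nat (c := 2 * Real.exp 3) (by positivity)).eventually_lt_const
        hη)).exists
    exact ⟨ℓ, h1, h2.le⟩
  have hη4 : 0 < η / 4 := by positivity
  obtain ⟨m, hm1, hm⟩ : ∃ m : ℕ, 1 ≤ m ∧ Real.logb 2 (Real.exp 3 * ℓ * m) / m ≤ η / 4 := by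
    obtain ⟨m, h1, h2⟩ := ((eventually_ge_atTop 1).and
      ((tendsto_logb_const_mul_div_nat (c := Real.exp 3 * ℓ) (by positivity)).eventually_lt_const
        hη4)).exists
    exact ⟨m, h1, h2.le⟩
  have hℓpos : 0 < ℓ := hℓ1
  have hℓR : (1 : ℝ) ≤ ℓ := by exact_mod_cast hℓ1
  have hmR : (1 : ℝ) ≤ m := by exact_mod_cast hm1
  refine ⟨1 / (2 * m), k * ℓ, by positivity, ?_⟩
  -- the family: `F_{⌊N/ℓ⌋}[⊕^ℓ]`, and `{∅}` below the threshold
  refine ⟨fun N => if n₀ ≤ N / ℓ then xorify ℓ (F (N / ℓ)) else [[]], fun N => ?_, ?_⟩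
  · by_cases h : n₀ ≤ N / ℓ
    · simp only [if_pos h]
      obtain ⟨hw, hv, hu, -⟩ := hF (N / ℓ) h
      exact ⟨isWidthLE_xorify hw, (numVars_xorify_le ℓ _).trans
          ((Nat.mul_le_mul_left ℓ hv).trans (by rw [mul_comm]; exact Nat.div_mul_le_self N ℓ)),
        xorify_not_satisfiable hu⟩
    · simp only [if_neg h]
      refine ⟨fun c hc => ?_, by simp [CNF.numVars], CNF.not_satisfiable_of_nil_mem (by simp)⟩
      simp only [List.mem_singleton] at hc
      simp [hc]
  · -- the lower bound for all large `N`
    have hthr : ∀ᶠ N : ℕ in atTop, ℓ * max n₀ (max 4 ⌈1 / (2 * η)⌉₊) ≤ N := eventually_ge_atTop _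
    filter_upwards [hthr] with N hN π hπ hreg
    -- `n = ⌊N / ℓ⌋` is large
    set n : ℕ := N / ℓ with hn_def
    have hn : max n₀ (max 4 ⌈1 / (2 * η)⌉₊) ≤ n := (Nat.le_div_iff_mul_le hℓpos).2 (by
      rw [mul_comm]; exact hN)
    have hn₀n : n₀ ≤ n := le_trans (le_max_left _ _) hn
    have hn4 : 4 ≤ n := le_trans (le_trans (le_max_left _ _) (le_max_right _ _)) hn
    have hceil : ⌈1 / (2 * η)⌉₊ ≤ n := le_trans (le_trans (le_max_right _ _) (le_max_right _ _)) hn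
    have hnη : 1 / (2 * η) ≤ (n : ℝ) := le_trans (Nat.le_ceil _) (by exact_mod_cast hceil)
    have hnR : (4 : ℝ) ≤ n := by exact_mod_cast hn4
    have hnpos : (0 : ℝ) < n := by linarith
    have hNlt : (N : ℝ) < n * ℓ + ℓ := by
      have := Nat.lt_div_mul_add (a := N) hℓpos
      exact_mod_cast this
    have hNge : (n : ℝ) * ℓ ≤ N := by exact_mod_cast Nat.div_mul_le_self N ℓ
    simp only [if_pos hn₀n] at hπ
    obtain ⟨-, hvF, huF, hwidth⟩ := hF n hn₀n
    -- the width parameter `w = ⌊(1 - 2η) n⌋`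
    set w : ℕ := ⌊(1 - 2 * η) * n⌋₊ with hw_def
    have h2η : 0 ≤ 1 - 2 * η := by linarith
    have hwle : (w : ℝ) ≤ (1 - 2 * η) * n := Nat.floor_le (by positivity)
    have hwge : (1 - 2 * η) * n - 1 ≤ w := by
      have := Nat.lt_floor_add_one ((1 - 2 * η) * n)
      linarith
    have hwn2 : (n : ℝ) / 2 ≤ w := by nlinarith
    have hwpos : (0 : ℝ) < w := by linarith
    have hw_lt : ∀ π' : List (ResLine ℕ), IsResRefutation (F n) π' → w < resWidth π' := by
      intro π' hπ'
      have h1 := hwidth π' hπ'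
      have h2 : (w : ℝ) < resWidth π' := by
        calc (w : ℝ) ≤ (1 - 2 * η) * n := hwle
          _ < (1 - ζ k) * n := by nlinarith
          _ ≤ resWidth π' := h1
      exact_mod_cast h2
    -- `δ`-regularity with respect to the `nℓ` variables of `F_n[⊕^ℓ]`
    have hmpos : (0 : ℝ) < m := by linarith
    have hreg' : IsDeltaRegular (1 / m) (n * ℓ) π := by
      refine hreg.of_mul_le ?_
      rw [Nat.cast_mul]
      have : (N : ℝ) ≤ 2 * (n * ℓ) := by nlinarith
      calc 1 / (2 * (m : ℝ)) * N ≤ 1 / (2 * (m : ℝ)) * (2 * (n * ℓ)) := by gcongr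
        _ = 1 / m * (n * ℓ) := by field_simp
    have hmain := hX (F n) n w ℓ (1 / m) huF hvF (by positivity)
      (by rw [div_le_one hmpos]; exact hmR) hw_lt π hπ hreg'
    refine le_trans (Real.rpow_le_rpow_of_exponent_le (by norm_num) ?_) hmain
    -- the exponent comparison `(1 - ε) N ≤ (1 - ε') w ℓ`
    have hloss : xorLiftLoss n w ℓ (1 / m) ≤ 2 * η := by
      unfold xorLiftLoss
      have hnw : (n : ℝ) / w ≤ 2 := by
        rw [div_le_iff₀ hwpos]; linarith
      have e3pos : (0 : ℝ) < Real.exp 3 := Real.exp_pos 3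
      -- first summand
      have hA : 1 / (ℓ : ℝ) * Real.logb 2 (Real.exp 3 * ℓ * n / w) ≤ η := by
        have hx : (0 : ℝ) < Real.exp 3 * ℓ * n / w := by positivity
        have hxy : Real.exp 3 * ℓ * n / w ≤ 2 * Real.exp 3 * ℓ := by
          rw [mul_div_assoc]
          calc Real.exp 3 * ℓ * (n / w) ≤ Real.exp 3 * ℓ * 2 := by gcongr
            _ = 2 * Real.exp 3 * ℓ := by ring
        calc 1 / (ℓ : ℝ) * Real.logb 2 (Real.exp 3 * ℓ * n / w)
            ≤ 1 / (ℓ : ℝ) * Real.logb 2 (2 * Real.exp 3 * ℓ) :=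
              mul_le_mul_of_nonneg_left (Real.logb_le_logb_of_le one_lt_two hx hxy)
                (by positivity)
          _ = Real.logb 2 (2 * Real.exp 3 * ℓ) / ℓ := by ring
          _ ≤ η := hℓ
      -- second summand
      have hB : 1 / (m : ℝ) * n / w * Real.logb 2 (Real.exp 3 * ℓ / (1 / m)) ≤ η := by
        have hsimp : Real.exp 3 * ℓ / (1 / (m : ℝ)) = Real.exp 3 * ℓ * m := by
          field_simp
        rw [hsimp]
        have hlog0 : 0 ≤ Real.logb 2 (Real.exp 3 * ℓ * m) := by
          refine Real.logb_nonneg one_lt_two ?_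
          have : (1 : ℝ) ≤ Real.exp 3 := by
            have := Real.add_one_le_exp (3 : ℝ); linarith
          calc (1 : ℝ) = 1 * 1 * 1 := by ring
            _ ≤ Real.exp 3 * ℓ * m := by gcongr
        calc 1 / (m : ℝ) * n / w * Real.logb 2 (Real.exp 3 * ℓ * m)
            = (n / w) * (Real.logb 2 (Real.exp 3 * ℓ * m) / m) := by ring
          _ ≤ 2 * (η / 4) := by gcongr
          _ ≤ η := by linarith
      linarith
    have hwℓ : (0 : ℝ) ≤ (w : ℝ) * ℓ := by positivity
    have h2ηn : 1 ≤ 2 * η * n := by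
      rw [div_le_iff₀ (by positivity)] at hnη; linarith
    have hA : 0 ≤ (ℓ : ℝ) * (4 * η * n - 2) := mul_nonneg (by positivity) (by linarith)
    have hB : 0 ≤ η * (ℓ : ℝ) := by positivity
    have hC : 0 ≤ η ^ 2 * n * (ℓ : ℝ) := by positivity
    calc (1 - ε) * (N : ℝ) ≤ (1 - 8 * η) * N := by
          apply mul_le_mul_of_nonneg_right (by linarith) (by positivity)
      _ ≤ (1 - 8 * η) * (n * ℓ + ℓ) := by
          apply mul_le_mul_of_nonneg_left hNlt.le (by linarith)
      _ ≤ (1 - 4 * η) * (n * ℓ) - ℓ := by linarith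
      _ ≤ (1 - 2 * η) * (((1 - 2 * η) * n - 1) * ℓ) := by linarith
      _ ≤ (1 - 2 * η) * (w * ℓ) := by
          apply mul_le_mul_of_nonneg_left _ h2η
          exact mul_le_mul_of_nonneg_right hwge (by positivity)
      _ ≤ (1 - xorLiftLoss n w ℓ (1 / m)) * (w * ℓ) := by
          apply mul_le_mul_of_nonneg_right (by linarith) hwℓ
      _ = (1 - xorLiftLoss n w ℓ (1 / m)) * w * ℓ := by ring

/-- The regular-resolution case follows from the `δ`-regular one (regular refutations are
`δ`-regular for every `δ ≥ 0`, `IsRegular.isDeltaRegular`); this is the interim file's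
preserved derivation of `regularRes_SETH` (Beck–Impagliazzo 2013, Thm 1.1) from
`deltaRegularRes_SETH`. [Bonacina–Talebanfard 2015, §1; Beck–Impagliazzo 2013]
[cite: BonacinaTalebanfard2015, §1] -/
theorem regularRes_SETH_of_deltaRegularRes_SETH (h : deltaRegularRes_SETH) : regularRes_SETH := by
  intro ε hε
  obtain ⟨δ, k, hδ, φ, hφ, h⟩ := h ε hε
  exact ⟨k, φ, hφ, h.mono fun n hn π hπ hreg => hn π hπ (hreg.isDeltaRegular hδ.le n)⟩

/-- **`deltaRegularRes_SETH` from the expanding systems alone** (Bonacina 2017, Cor. 8.2, with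
Thm 8.1 and Thm 8.2 proved in the tree from Prop. 8.1): expanding unsatisfiable linear systems
mod `p` (`fpExpandingSystem`, Bonacina 2017 Prop. 8.1 = Beck–Impagliazzo 2013 Lemma 4.2) imply
the proof-complexity SETH for `δ`-regular resolution.
[Bonacina 2017, Cor. 8.2] [cite: Bonacina2017, Cor. 8.2] -/
theorem deltaRegularRes_SETH_of_fpExpandingSystem (h : fpExpandingSystem) : deltaRegularRes_SETH :=
  deltaRegularRes_SETH_of_strongResWidth_of_xorification
    (strongResWidth_kCNF_of_fpExpandingSystem h) BonacinaTalebanfard2016_xorification_holds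

/-- **Discharge of the named fact `deltaRegularRes_SETH`** (Bonacina 2017, Cor. 8.2 =
Bonacina–Talebanfard IPEC 2015, Cor. 6: "a version of SETH holds for `δ`-regular
resolution"): for every `ε > 0` there are `δ > 0`, `k` and unsatisfiable `k`-CNFs `φ_n` on
`≤ n` variables all of whose `δ`-regular resolution refutations eventually have at least
`2^{(1-ε)n}` lines. Proof: Cor. 8.2's assembly
(`deltaRegularRes_SETH_of_strongResWidth_of_xorification`) applied to the discharged width
fact `strongResWidth_kCNF_holds` (Thm 8.1, from Prop. 8.1 = `fpExpandingSystem_holds`) and the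
discharged xorification lift `BonacinaTalebanfard2016_xorification_holds` (Thm 8.2). Users
holding `(h : deltaRegularRes_SETH)` are fed this theorem.
[Bonacina 2017, Cor. 8.2; Bonacina–Talebanfard 2015, Cor. 6] [cite: Bonacina2017, Cor. 8.2]
[cite: BonacinaTalebanfard2015, Cor. 6] -/
theorem deltaRegularRes_SETH_holds : deltaRegularRes_SETH :=
  deltaRegularRes_SETH_of_strongResWidth_of_xorification
    strongResWidth_kCNF_holds BonacinaTalebanfard2016_xorification_holds

/-- The regular case (`regularRes_SETH`, Beck–Impagliazzo 2013 Thm 1.1) from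
`fpExpandingSystem` alone. [Bonacina 2017, Cor. 8.2; Beck–Impagliazzo 2013, Thm 1.1]
[cite: Bonacina2017, Cor. 8.2] -/
theorem regularRes_SETH_of_fpExpandingSystem (h : fpExpandingSystem) : regularRes_SETH :=
  regularRes_SETH_of_deltaRegularRes_SETH (deltaRegularRes_SETH_of_fpExpandingSystem h)

/-- **Discharge of the named fact `regularRes_SETH`** (Beck–Impagliazzo STOC 2013, "Strong ETH
holds for regular resolution": "there are unsatisfiable `k`-CNF formulas in `n` variables
requiring refutations of size at least `2^{n(1-ε_k)}` in regular Resolution" as quoted in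
Bonacina–Talebanfard 2015, §1, p. 250; Beck 2017, Thm 5.8; Bonacina 2017, Cor. 8.2 at `δ = 0`):
for every `ε > 0` there are `k` and unsatisfiable `k`-CNFs `φ_n` on `≤ n` variables all of whose
regular resolution refutations eventually have at least `2^{(1-ε)n}` lines — the `δ = 0` case of
`deltaRegularRes_SETH_holds` (`regularRes_SETH_of_deltaRegularRes_SETH`). Users holding
`(h : regularRes_SETH)` are fed this theorem.
[Beck–Impagliazzo 2013; Beck 2017, Thm 5.8; Bonacina 2017, Cor. 8.2]
[cite: BeckImpagliazzo2013, main theorem] [cite: Beck2017, Thm 5.8]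
[cite: Bonacina2017, Cor. 8.2] [cite: BonacinaTalebanfard2015, §1 p. 250] -/
theorem regularRes_SETH_holds : regularRes_SETH :=
  regularRes_SETH_of_deltaRegularRes_SETH deltaRegularRes_SETH_holds

end Literature.Computability.FineGrained
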